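import Mathlib
import Summits.NavierStokesRegularity.NavierStokesRegularity.Theorems.FilamentSkeletonRssSkeletonJ1RMonoInverse

/-!
# Route `FilamentSkeletonRss` · crux `SkeletonJ1R` (stmt-NavierStokesRegularity-23610) · registered line `streamline_kantorovich_R`
# — brick F(i)-h for stub F1 `LiaFrameExistsL`: the DATUM-SLICED ARM MODEL exists (explicit construction, no tubular-neighbourhood calculus)

Lead `ns-fsr-lead-23610` (g0), `--supports stmt-NavierStokesRegularity-23610 --as helper`; generic (no line-vocabulary import): the conclusion is the
body of `SkeletonJ1RFrame.SlicedModel` (FrameDefs §5) for a family of `C³` unit-speed curves `x_j` with tilt `‖x_j′ − t_j‖ ≤ 1` against unit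
directions `t_j` and mutual separation `4r`.

CONSTRUCTION (`slicedModel_exists`).  Axial coordinate `a_j(y) = ⟪y − x_j 0, t_j⟫` (affine); `g_j = a_j ∘ x_j` has `g_j′ = ⟪x_j′, t_j⟫ ≥ ½`, so by
`exists_contDiff_inverse_of_deriv_ge` it has a `C³` inverse `G_j` (2-Lipschitz); the retraction `h_j = G_j ∘ a_j` satisfies `h_j(x_j τ + z) = τ` for
`z ⊥ t_j`; the arm field `M_j(y) = (7/4)h_j(y)·x_j′(h_j y) − λ(y − x_j(h_j y))` is `C²` with linear growth and equals `(7/4)τ·x_j′ τ − λz` on the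
slice; the bump `ψ_j(y) = χ((4r² − ‖y − x_j(h_j y)‖²)/(3r²))` (`χ = Real.smoothTransition`) is `C²`, `= 1` within slice distance `r` and `= 0` beyond `2r`;
`M = Σ_j ψ_j • M_j` is `C²`, of linear growth, and on the slice of curve `j` of radius `r` every other bump vanishes (separation `4r`), so
`M(x_j τ + z) = (7/4)τ·x_j′ τ − λz`.

HONEST FRAMING.  Calculus bookkeeping for the ∃-side of a HYPOTHETICAL filament-type rotating-self-similar blow-up skeleton (MODEL rung, negative
side); nothing here is a claim about Navier–Stokes regularity or blow-up; stub F1 and the crux stay OPEN.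
-/

set_option linter.dupNamespace false -- `NavierStokesRegularity.NavierStokesRegularity` path/namespace repetition is the tree convention

noncomputable section

namespace Summit.NavierStokesRegularity.NavierStokesRegularity.Theorems.SkeletonJ1RFrame

open Set Function Filter Real Topology
open scoped InnerProductSpace BigOperators

/-- For unit vectors `u, t`: `⟪u, t⟫ = 1 − ½‖u − t‖²`. [folklore] -/
theorem inner_eq_one_sub_half_norm_sub_sq (u t : EuclideanSpace ℝ (Fin 3)) (hu : ‖u‖ = 1) (ht : ‖t‖ = 1) :
    inner ℝ u t = 1 - ‖u - t‖ ^ 2 / 2 := by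
  rw [norm_sub_sq_real, hu, ht]; ring

/-- **One arm.**  For a `C³` unit-speed curve `x` with tilt `‖x′ − t‖ ≤ 1` against a unit vector `t` there are a `C²` retraction `h : ℝ³ → ℝ` with
`h (x τ + z) = τ` for `z ⊥ t` and `|h y| ≤ 2(‖y‖ + ‖x 0‖)`, and hence a `C²` arm field `A` of linear growth with `A (x τ + z) = (7/4)τ·x′ τ − λ z` for
all `z ⊥ t`, together with a `C²` squared slice distance `d` with `d (x τ + z) = ‖z‖²` (`z ⊥ t`) and `d y = ‖y − x (h y)‖²`. [folklore] -/
theorem arm_exists {x : ℝ → EuclideanSpace ℝ (Fin 3)} (hx : ContDiff ℝ 3 x) (hunit : ∀ τ, ‖deriv x τ‖ = 1) {t : EuclideanSpace ℝ (Fin 3)}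
    (ht : ‖t‖ = 1) (htilt : ∀ τ, ‖deriv x τ - t‖ ≤ 1) (lam : ℝ) :
    ∃ (h : EuclideanSpace ℝ (Fin 3) → ℝ) (A : EuclideanSpace ℝ (Fin 3) → EuclideanSpace ℝ (Fin 3)),
      ContDiff ℝ 2 h ∧ ContDiff ℝ 2 A ∧ (∀ τ (z : EuclideanSpace ℝ (Fin 3)), inner ℝ z t = 0 → h (x τ + z) = τ) ∧
      (∀ y, |h y| ≤ 2 * (‖y‖ + ‖x 0‖)) ∧ (∀ y, ‖A y‖ ≤ (11/2 + 3 * |lam|) * (‖y‖ + ‖x 0‖)) ∧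
      (∀ y, A y = ((7/4:ℝ) * h y) • deriv x (h y) - lam • (y - x (h y))) ∧
      ∀ τ (z : EuclideanSpace ℝ (Fin 3)), inner ℝ z t = 0 → A (x τ + z) = ((7/4:ℝ) * τ) • deriv x τ - lam • z := by
  have hxd : Differentiable ℝ x := hx.differentiable (by norm_num)
  -- the axial parametrisation g = a ∘ x and its inverse
  set g : ℝ → ℝ := fun τ => inner ℝ (x τ - x 0) t with hg
  have hgd : ∀ τ, HasDerivAt g (inner ℝ (deriv x τ) t) τ := fun τ => by
    have h1 : HasDerivAt (fun τ => x τ - x 0) (deriv x τ) τ := by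
      simpa using (hxd τ).hasDerivAt.sub_const (x 0)
    have h2 := h1.inner ℝ (hasDerivAt_const τ t)
    simpa using h2
  have hgC : ContDiff ℝ 3 g := by
    have : ContDiff ℝ 3 fun τ => x τ - x 0 := hx.sub contDiff_const
    exact this.inner ℝ contDiff_const
  have hg' : ∀ τ, (1/2 : ℝ) ≤ deriv g τ := fun τ => by
    rw [(hgd τ).deriv, inner_eq_one_sub_half_norm_sub_sq _ _ (hunit τ) ht]
    have h := htilt τ
    have : ‖deriv x τ - t‖ ^ 2 ≤ 1 := by nlinarith [norm_nonneg (deriv x τ - t)]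
    linarith
  obtain ⟨G, hGC, hGg, hgG, hGlip⟩ := exists_contDiff_inverse_of_deriv_ge hgC (by norm_num) (by norm_num : (0:ℝ) < 1/2) hg'
  -- the retraction
  set a : EuclideanSpace ℝ (Fin 3) → ℝ := fun y => inner ℝ (y - x 0) t with ha
  have haC : ContDiff ℝ 3 a := (contDiff_id.sub contDiff_const).inner ℝ contDiff_const
  set h : EuclideanSpace ℝ (Fin 3) → ℝ := fun y => G (a y) with hh
  have hhC : ContDiff ℝ 3 h := hGC.comp haC
  have hslice : ∀ τ (z : EuclideanSpace ℝ (Fin 3)), inner ℝ z t = 0 → h (x τ + z) = τ := by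
    intro τ z hz
    simp only [hh, ha]
    rw [show x τ + z - x 0 = (x τ - x 0) + z by abel, inner_add_left, hz, add_zero]
    exact hGg τ
  have hg0 : g 0 = 0 := by simp [hg]
  have hG0 : G 0 = 0 := by have := hGg 0; rwa [hg0] at this
  have hhbound : ∀ y, |h y| ≤ 2 * (‖y‖ + ‖x 0‖) := by
    intro y
    have h1 := hGlip (a y) 0
    rw [hG0, sub_zero, sub_zero] at h1
    have h2 : |a y| ≤ ‖y‖ + ‖x 0‖ := by
      simp only [ha]
      calc |inner ℝ (y - x 0) t| ≤ ‖y - x 0‖ * ‖t‖ := abs_real_inner_le_norm _ _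
        _ = ‖y - x 0‖ := by rw [ht, mul_one]
        _ ≤ ‖y‖ + ‖x 0‖ := norm_sub_le _ _
    simp only [hh]
    calc |G (a y)| ≤ |a y| / (1/2) := h1
      _ = 2 * |a y| := by ring
      _ ≤ 2 * (‖y‖ + ‖x 0‖) := by linarith
  -- the arm field
  have hx'C : ContDiff ℝ 2 (deriv x) := (contDiff_succ_iff_deriv.1 (show ContDiff ℝ (2 + 1) x from hx)).2.2
  set A : EuclideanSpace ℝ (Fin 3) → EuclideanSpace ℝ (Fin 3) := fun y => ((7/4:ℝ) * h y) • deriv x (h y) - lam • (y - x (h y)) with hA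
  have hhC2 : ContDiff ℝ 2 h := hhC.of_le (by norm_num)
  have hAC : ContDiff ℝ 2 A := by
    refine ((contDiff_const.mul hhC2).smul (hx'C.comp hhC2)).sub
      ((contDiff_const (c := lam)).smul (contDiff_id.sub ((hx.of_le (by norm_num)).comp hhC2)))
  refine ⟨h, A, hhC2, hAC, hslice, hhbound, fun y => ?_, fun y => rfl, fun τ z hz => ?_⟩
  · -- linear growth
    have h1 : ‖((7/4:ℝ) * h y) • deriv x (h y)‖ = 7/4 * |h y| := by
      rw [norm_smul, hunit, mul_one, Real.norm_eq_abs, abs_mul, abs_of_pos (by norm_num : (0:ℝ) < 7/4)]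
    have h2 : ‖x (h y)‖ ≤ ‖x 0‖ + |h y| := by
      have := Convex.norm_image_sub_le_of_norm_deriv_le (f := x) (fun v _ => hxd v) (fun v _ => (hunit v).le) convex_univ
        (mem_univ 0) (mem_univ (h y))
      rw [one_mul, sub_zero, Real.norm_eq_abs] at this
      calc ‖x (h y)‖ = ‖x 0 + (x (h y) - x 0)‖ := by rw [add_sub_cancel]
        _ ≤ ‖x 0‖ + ‖x (h y) - x 0‖ := norm_add_le _ _
        _ ≤ ‖x 0‖ + |h y| := by linarith
    have h3 : ‖lam • (y - x (h y))‖ ≤ |lam| * (‖y‖ + ‖x 0‖ + |h y|) := by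
      rw [norm_smul, Real.norm_eq_abs]
      exact mul_le_mul_of_nonneg_left ((norm_sub_le _ _).trans (by linarith)) (abs_nonneg _)
    have hb := hhbound y
    calc ‖A y‖ ≤ ‖((7/4:ℝ) * h y) • deriv x (h y)‖ + ‖lam • (y - x (h y))‖ := norm_sub_le _ _
      _ ≤ 7/4 * |h y| + |lam| * (‖y‖ + ‖x 0‖ + |h y|) := by rw [h1]; linarith
      _ ≤ (11/2 + 3 * |lam|) * (‖y‖ + ‖x 0‖) := by
          have hl : 0 ≤ |lam| := abs_nonneg _
          have hn : 0 ≤ ‖y‖ + ‖x 0‖ := by positivity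
          nlinarith
  · -- slice formula
    simp only [hA]
    rw [hslice τ z hz, show x τ + z - x τ = z by abel]

/-- **THE DATUM-SLICED MODEL EXISTS.**  For `C³` unit-speed curves `x_j` with tilt `‖x_j′ − t_j‖ ≤ 1` against unit directions `t_j` and mutual
separation `4r` (`r > 0`), there is a `C²` field `M` of linear growth with `M (x_j τ + z) = (7/4)τ·x_j′ τ − λz` for every `j`, `τ` and every
`z ⊥ t_j` with `‖z‖ ≤ r`. [folklore] -/
theorem slicedModel_exists {N : ℕ} {x : Fin N → ℝ → EuclideanSpace ℝ (Fin 3)} (hx : ∀ j, ContDiff ℝ 3 (x j))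
    (hunit : ∀ j τ, ‖deriv (x j) τ‖ = 1) {t : Fin N → EuclideanSpace ℝ (Fin 3)} (ht : ∀ j, ‖t j‖ = 1)
    (htilt : ∀ j τ, ‖deriv (x j) τ - t j‖ ≤ 1) {r : ℝ} (hr : 0 < r) (hsep : ∀ j k, j ≠ k → ∀ τ σ, 4 * r ≤ ‖x j τ - x k σ‖) (lam : ℝ) :
    ∃ M : EuclideanSpace ℝ (Fin 3) → EuclideanSpace ℝ (Fin 3), ContDiff ℝ 2 M ∧ (∃ C : ℝ, ∀ y, ‖M y‖ ≤ C * (1 + ‖y‖)) ∧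
      ∀ j τ (z : EuclideanSpace ℝ (Fin 3)), inner ℝ z (t j) = 0 → ‖z‖ ≤ r → M (x j τ + z) = ((7/4:ℝ) * τ) • deriv (x j) τ - lam • z := by
  choose h A hhC hAC hslice hhb hAb hAdef hAslice using fun j => arm_exists (hx j) (hunit j) (ht j) (htilt j) lam
  -- bumps
  set d : Fin N → EuclideanSpace ℝ (Fin 3) → ℝ := fun j y => ‖y - x j (h j y)‖ ^ 2 with hd
  have hdC : ∀ j, ContDiff ℝ 2 (d j) := fun j =>
    (contDiff_id.sub (((hx j).of_le (by norm_num)).comp (hhC j))).norm_sq ℝ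
  set ψ : Fin N → EuclideanSpace ℝ (Fin 3) → ℝ := fun j y => Real.smoothTransition ((4 * r ^ 2 - d j y) / (3 * r ^ 2)) with hψ
  have hψC : ∀ j, ContDiff ℝ 2 (ψ j) := fun j =>
    Real.smoothTransition.contDiff.comp ((contDiff_const.sub (hdC j)).div_const _)
  have hψ01 : ∀ j y, 0 ≤ ψ j y ∧ ψ j y ≤ 1 := fun j y => ⟨Real.smoothTransition.nonneg _, Real.smoothTransition.le_one _⟩
  have hr2 : 0 < 3 * r ^ 2 := by positivity
  have hψone : ∀ j y, d j y ≤ r ^ 2 → ψ j y = 1 := fun j y hdy =>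
    Real.smoothTransition.one_of_one_le (by rw [le_div_iff₀ hr2]; linarith)
  have hψzero : ∀ j y, 4 * r ^ 2 ≤ d j y → ψ j y = 0 := fun j y hdy =>
    Real.smoothTransition.zero_of_nonpos (div_nonpos_of_nonpos_of_nonneg (by linarith) hr2.le)
  -- the model
  refine ⟨fun y => ∑ j, ψ j y • A j y, ContDiff.sum fun j _ => (hψC j).smul (hAC j), ?_, fun j τ z hz hzr => ?_⟩
  · -- linear growth
    refine ⟨∑ j, (11/2 + 3 * |lam|) * (1 + ‖x j 0‖), fun y => ?_⟩
    rw [Finset.sum_mul]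
    refine (norm_sum_le _ _).trans (Finset.sum_le_sum fun j _ => ?_)
    rw [norm_smul, Real.norm_of_nonneg (hψ01 j y).1]
    calc ψ j y * ‖A j y‖ ≤ 1 * ‖A j y‖ := mul_le_mul_of_nonneg_right (hψ01 j y).2 (norm_nonneg _)
      _ ≤ (11/2 + 3 * |lam|) * (‖y‖ + ‖x j 0‖) := by rw [one_mul]; exact hAb j y
      _ ≤ (11/2 + 3 * |lam|) * (1 + ‖x j 0‖) * (1 + ‖y‖) := by
          have h1 : 0 ≤ 11/2 + 3 * |lam| := by positivity
          have h2 : ‖y‖ + ‖x j 0‖ ≤ (1 + ‖x j 0‖) * (1 + ‖y‖) := by nlinarith [norm_nonneg y, norm_nonneg (x j 0)]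
          calc (11/2 + 3 * |lam|) * (‖y‖ + ‖x j 0‖) ≤ (11/2 + 3 * |lam|) * ((1 + ‖x j 0‖) * (1 + ‖y‖)) :=
                mul_le_mul_of_nonneg_left h2 h1
            _ = (11/2 + 3 * |lam|) * (1 + ‖x j 0‖) * (1 + ‖y‖) := by ring
  · -- slice formula: only the bump of `j` is on
    have hdj : d j (x j τ + z) = ‖z‖ ^ 2 := by
      simp only [hd]; rw [hslice j τ z hz, show x j τ + z - x j τ = z by abel]
    have hψj : ψ j (x j τ + z) = 1 := hψone j _ (by rw [hdj]; exact pow_le_pow_left₀ (norm_nonneg _) hzr 2)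
    have hψk : ∀ k, k ≠ j → ψ k (x j τ + z) = 0 := by
      intro k hk
      apply hψzero
      simp only [hd]
      have hfar : 3 * r ≤ ‖x j τ + z - x k (h k (x j τ + z))‖ := by
        have h1 := hsep j k (Ne.symm hk) τ (h k (x j τ + z))
        have h2 : ‖x j τ - x k (h k (x j τ + z))‖ ≤ ‖x j τ + z - x k (h k (x j τ + z))‖ + ‖z‖ := by
          have := norm_sub_le (x j τ + z - x k (h k (x j τ + z))) z
          rwa [show x j τ + z - x k (h k (x j τ + z)) - z = x j τ - x k (h k (x j τ + z)) by abel] at this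
        linarith
      nlinarith [hr]
    show (∑ k, ψ k (x j τ + z) • A k (x j τ + z)) = _
    rw [Finset.sum_eq_single j (fun k _ hk => by rw [hψk k hk, zero_smul]) (fun hj => absurd (Finset.mem_univ j) hj), hψj, one_smul]
    exact hAslice j τ z hz

end Summit.NavierStokesRegularity.NavierStokesRegularity.Theorems.SkeletonJ1RFrame

end
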